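/-
Copyright (c) 2026 the pub-hodgecm-mathlib formalisation cell (harness21).  Prover seat hodgecm-mathlib-B-p04 (g30), topic T5 = P8
«(C♯)hol interior», row «T5-B(1b)» (desk F0P2-plan (g8) «=» 2026-08-31T16:31:54Z), 2026-08-31.  KERNEL module: THEOREMS ONLY (no
definition, no named fact, no `sorry`, no instance, no notation).
-/
import Literature.NumberTheory.Automorphic.Liu2021.ThetaLiftFromLineChiDescent
import HarnessLib

/-!
# Node B of the T5 line, step (1b) PROVED: PURE-TENSOR REDUCTION — the theta lift meeting `P` may be taken at a FACTORIZABLE `Φ = Φ_∞ ⊗ Φ_f`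

Topic `NumberTheory/Automorphic/Liu2021`; namespace `Literature.NumberTheory.Automorphic.Liu2021`.  KERNEL: theorems only.  Cell hodgecm-mathlib
FLOOR 0, programme P2, topic T5 = P8 «(C♯)hol interior» (`F0/P2/T5b-TREE.md` §8.2, node B «finite local–global», step (1b)).

[Liu2021, proof of Prop. 4.13, Case 1, l. 2135–2137] passes from the global theta lift `Θ_Φ(χ)` to the finite oscillator representation
`ω_f(μ, ε_a, χ)`; the passage needs the Schwartz–Bruhat datum in the form `Φ = Φ_∞ ⊗ Φ_f` (then `Φ_f ↦ pr_P [Θ̃_{Φ_∞ ⊗ Φ_f}(χ) ∘ ιA]` is the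
finite intertwiner of step (3b)).  The tree's adelic Schwartz–Bruhat space is BY DEFINITION the `ℂ`-span of the factorizable functions
(★ `piSchwartzBruhat K ι := Submodule.span ℂ {Φ | IsFactorizablePiSchwartzBruhat K ι Φ}`, `AdelicPiSchwartzBruhatFourier`), and the class
`Φ ↦ [Θ̃_Φ(f) ∘ ιA] ∈ L²([U(H)])` is `ℂ`-LINEAR in `Φ` (Weil's theta distribution is linear: ★ `lineThetaKernelDatum_thetaLinear`, ★
`ThetaKernelDatum.thetaLift_add_left ∕ thetaLift_smul_left`); so a linear map that does not kill the class of SOME `Φ` does not kill the class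
of some PURE TENSOR `Φ_∞ ⊗ Φ_f` (exact span — `Submodule.span_induction`, no closure argument):

* §1 (generic rank `N`, the frame of ★ `ThetaLiftFromLineCharacters` §3): `toQuotFun_lineThetaLift_add_left ∕ _smul_left` (the `Φ`-variable
  twins of ★ `toQuotFun_lineThetaLift_add ∕ _smul`), `toLp_lineThetaLift_add_left ∕ _smul_left` (the `L²`-classes), and
  **`exists_tensor_of_apply_toLp_lineThetaLift_ne_zero`** — for a `ℂ`-linear `T : L²([U(H)], ν) → X` with `T [Θ̃_Φ(f) ∘ ιA] ≠ 0` there are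
  `Φ_∞ : 𝓢((L⁺ ⊗ ℝ)^{n′})`, `Φ_f ∈ 𝒮((𝔸_{L⁺}^∞)^{n′})` with `T [Θ̃_{Φ_∞ ⊗ Φ_f}(f) ∘ ιA] ≠ 0`.
* §2 (`N = 3`, the (C♯)hol frame): **`MeetsThetaLiftFromLine.exists_chi_starProjection_ne_zero_of_holCotForm_tensor`** = ★
  `MeetsThetaLiftFromLine.exists_chi_starProjection_ne_zero_of_holCotForm` (p828206) with its Schwartz–Bruhat witness `Φ` REPLACED by a pure
  tensor `(Φinf, Φfin, hfin)`, every other binder and the existential order kept (the (3b) hand consumes it by `obtain`), and the predicate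
  form `…_factorizable` (`IsFactorizablePiSchwartzBruhat`).

HONEST SCOPE.  Nothing of [Liu2021] is asserted; this file books nothing and discharges nothing booked (it pays step (1b) of the in-house node B
of the booked letter #87 (C♯)hol).  HC_CM is proved only modulo the printed citations until rung 0 closes.

## References
* [Liu2021] Y. Liu, *Fourier–Jacobi cycles and arithmetic relative trace formula*, Camb. J. Math. 9 (2021) = arXiv:2102.11518, proof of
  Prop. 4.13 Case 1 (l. 2131–2137, p. 48).
* [Weil1964] A. Weil, *Sur certains groupes d'opérateurs unitaires*, Acta Math. 111 (1964), Chap. III n° 41 Thm 6 p. 193 (the theta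
  distribution is a tempered distribution, in particular linear).
* [TateThesis1967] J. Tate, *Fourier analysis in number fields and Hecke's zeta-functions*, in Cassels–Fröhlich (1967), §3.2, §4.2 (standard =
  factorizable Schwartz–Bruhat functions span).
* [FleigEtAl2018] P. Fleig, H. Gustafsson, A. Kleinschmidt, D. Persson, CUP (2018), §12.3 Def. 12.5 (12.37) p. 296 (the theta lift).
-/

set_option autoImplicit false

noncomputable section

open NumberField MeasureTheory IsDedekindDomain
open scoped Matrix Kronecker ComplexOrder ENNReal SchwartzMap Classical

namespace Literature.NumberTheory.Automorphic.Liu2021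

open _root_.MeasureTheory
open Literature.NumberTheory.Automorphic Literature.NumberTheory.Automorphic.UnitaryGroup
open Literature.NumberTheory.Automorphic.UnitaryGroup.CotangentForms
open Literature.NumberTheory.Automorphic.IdeleClassGroup
open Literature.NumberTheory.Automorphic.Liu2021.Def411WeilCarriers
open Literature.NumberTheory.Automorphic.Liu2021.Def411WeilCarriersDoubling
open Literature.NumberTheory.GelbartRogawski1991 Literature.NumberTheory.GelbartRogawski1991.UnitaryDualPair
open Literature.NumberTheory.Weil1964
open Literature.RepresentationTheory.Liu2021
open Literature.RepresentationTheory.CompactGroups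
open Literature.RepresentationTheory.HeisenbergGroup

/-! ## §1 Linearity of the lifted class in the Schwartz–Bruhat variable; pure-tensor reduction (generic rank `N`) -/

section Lift

variable (L : Type) [Field L] [NumberField L] [IsCMField L] (N : ℕ) (H : Matrix (Fin N) (Fin N) L)
  {n' : ℕ} (e₁ : Fin N × Fin 1 ≃ Fin n') (dV : Fin N → L) (hdV : ∀ i, IsCMField.complexConj L (dV i) = dV i)
  (hdV0 : ∀ i, dV i ≠ 0) (g : GL (Fin N) L)
  (hg : ((g : Matrix (Fin N) (Fin N) L).map (cmConjRingHom L))ᵀ * H * (g : Matrix (Fin N) (Fin N) L) = Matrix.diagonal dV)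
  (μ : Literature.NumberTheory.Automorphic.IdeleClassGroup L →ₜ* Circle) (hμ : IsConjugateSymplectic L μ) (a : (↥(maximalRealSubfield L))ˣ)
  (hρ : HasThetaMajorants fun
      (p : ↥(UnitaryGroup.adelic (↥(maximalRealSubfield L)) L (IsCMField.complexConj L) N (Matrix.diagonal dV)) × ↥(UnitaryGroup.adelic (↥(maximalRealSubfield L)) L (IsCMField.complexConj L) 1 (JW (↥(maximalRealSubfield L)) L a))) (Φ : piSchwartzBruhat (↥(maximalRealSubfield L)) (Fin n')) =>
        pairRep (↥(maximalRealSubfield L)) L (IsCMField.complexConj L) N 1 e₁ (Matrix.diagonal dV) (JW (↥(maximalRealSubfield L)) L a)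
          (chiSplittingLine L e₁ dV hdV hdV0 (toHeckeCharacter L μ) (isUnitary_toHeckeCharacter L μ)
            ((isOscillatorChar_toHeckeCharacter_iff μ).mpr hμ) (TW (↥(maximalRealSubfield L)) a)
            (isUnit_det_TW (↥(maximalRealSubfield L)) a) (JW (↥(maximalRealSubfield L)) L a) (JW_eq (↥(maximalRealSubfield L)) L a))
          p Φ)
  [CompactSpace (↥(UnitaryGroup.adelic (↥(maximalRealSubfield L)) L (IsCMField.complexConj L) N (Matrix.diagonal dV)) ⧸ (UnitaryGroup.toAdelic (↥(maximalRealSubfield L)) L (IsCMField.complexConj L) N (Matrix.diagonal dV)).range)] [MeasurableSpace (↥(UnitaryGroup.adelic (↥(maximalRealSubfield L)) L (IsCMField.complexConj L) 1 (JW (↥(maximalRealSubfield L)) L a)) ⧸ (UnitaryGroup.toAdelic (↥(maximalRealSubfield L)) L (IsCMField.complexConj L) 1 (JW (↥(maximalRealSubfield L)) L a)).range)] (μW : Measure (↥(UnitaryGroup.adelic (↥(maximalRealSubfield L)) L (IsCMField.complexConj L) 1 (JW (↥(maximalRealSubfield L)) L a)) ⧸ (UnitaryGroup.toAdelic (↥(maximalRealSubfield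 L)) L (IsCMField.complexConj L) 1 (JW (↥(maximalRealSubfield L)) L a)).range))
  (f : C((↥(UnitaryGroup.adelic (↥(maximalRealSubfield L)) L (IsCMField.complexConj L) 1 (JW (↥(maximalRealSubfield L)) L a)) ⧸ (UnitaryGroup.toAdelic (↥(maximalRealSubfield L)) L (IsCMField.complexConj L) 1 (JW (↥(maximalRealSubfield L)) L a)).range), ℂ))

/-- **Homogeneity in the Schwartz–Bruhat variable**: `[x] ↦ Θ_{c•Φ}(f)([ιA x]) = c • Θ_Φ(f)([ιA x])` (★ `thetaLift_smul_left` for the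
theta-linear datum ★ `lineThetaKernelDatum_thetaLinear`). [cite: Weil1964, Chap. III n° 41 Thm 6 p. 193]
[cite: FleigEtAl2018, §12.3 Def. 12.5 (12.37) p. 296] -/
theorem toQuotFun_lineThetaLift_smul_left (c : ℂ) (Φ : piSchwartzBruhat (↥(maximalRealSubfield L)) (Fin n')) :
    (toQuotFun (adelicGroupData (↥(maximalRealSubfield L)) L (IsCMField.complexConj L) N H) fun y => (lineThetaKernelDatum L N e₁ dV hdV hdV0 μ hμ a hρ).thetaLiftFun μW (c • Φ) f ((cmAdelicFrameTransport L N H dV g hg) y)) =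
      c • toQuotFun (adelicGroupData (↥(maximalRealSubfield L)) L (IsCMField.complexConj L) N H) fun y => (lineThetaKernelDatum L N e₁ dV hdV hdV0 μ hμ a hρ).thetaLiftFun μW Φ f ((cmAdelicFrameTransport L N H dV g hg) y) := by
  -- the generic lemma at `SX := 𝒮(𝔸^{n'})` with the theta-initial topology supplied explicitly (the `Module ℂ` instance of the type
  -- synonym `ThetaTop` is not found by instance synthesis through `AddCommGroup`; cf. ★ `cmThetaKernelDatum_line_thetaLift_cmPairRep_sub_smul_charCM`)
  have key : (lineThetaKernelDatum L N e₁ dV hdV hdV0 μ hμ a hρ).thetaLift μW (c • Φ) f =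
      c • (lineThetaKernelDatum L N e₁ dV hdV hdV0 μ hμ a hρ).thetaLift μW Φ f :=
    @ThetaKernelDatum.thetaLift_smul_left _ (↥(piSchwartzBruhat (↥(maximalRealSubfield L)) (Fin n'))) _ _
      (WeilThetaDatum.instTopologicalSpaceThetaTop _) _ _ _ _ _ _ _ _ _ _ (lineThetaKernelDatum L N e₁ dV hdV hdV0 μ hμ a hρ) _ _ _ _ μW
      (lineThetaKernelDatum_thetaLinear L N e₁ dV hdV hdV0 μ hμ a hρ) c Φ f
  funext q
  obtain ⟨x, rfl⟩ := QuotientGroup.mk_surjective q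
  simp only [Pi.smul_apply]
  rw [show (QuotientGroup.mk x : (adelicGroupData (↥(maximalRealSubfield L)) L (IsCMField.complexConj L) N H).automorphicQuotient) = (adelicGroupData (↥(maximalRealSubfield L)) L (IsCMField.complexConj L) N H).toAutomorphicQuotient x from rfl,
    toQuotFun_lineThetaLift_mk L N H e₁ dV hdV hdV0 g hg μ hμ a hρ μW (c • Φ) f x, toQuotFun_lineThetaLift_mk L N H e₁ dV hdV hdV0 g hg μ hμ a hρ μW Φ f x,
    key, ContinuousMap.smul_apply]

variable [BorelSpace (↥(UnitaryGroup.adelic (↥(maximalRealSubfield L)) L (IsCMField.complexConj L) 1 (JW (↥(maximalRealSubfield L)) L a)) ⧸ (UnitaryGroup.toAdelic (↥(maximalRealSubfield L)) L (IsCMField.complexConj L) 1 (JW (↥(maximalRealSubfield L)) L a)).range)] [IsFiniteMeasure μW]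

/-- **Additivity in the Schwartz–Bruhat variable**: `[x] ↦ Θ_{Φ₁+Φ₂}(f)([ιA x]) = Θ_{Φ₁}(f)([ιA x]) + Θ_{Φ₂}(f)([ιA x])` (★ `thetaLift_add_left`
for the theta-linear datum ★ `lineThetaKernelDatum_thetaLinear`). [cite: Weil1964, Chap. III n° 41 Thm 6 p. 193]
[cite: FleigEtAl2018, §12.3 Def. 12.5 (12.37) p. 296] -/
theorem toQuotFun_lineThetaLift_add_left (Φ₁ Φ₂ : piSchwartzBruhat (↥(maximalRealSubfield L)) (Fin n')) :
    (toQuotFun (adelicGroupData (↥(maximalRealSubfield L)) L (IsCMField.complexConj L) N H) fun y => (lineThetaKernelDatum L N e₁ dV hdV hdV0 μ hμ a hρ).thetaLiftFun μW (Φ₁ + Φ₂) f ((cmAdelicFrameTransport L N H dV g hg) y)) =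
      (toQuotFun (adelicGroupData (↥(maximalRealSubfield L)) L (IsCMField.complexConj L) N H) fun y => (lineThetaKernelDatum L N e₁ dV hdV hdV0 μ hμ a hρ).thetaLiftFun μW Φ₁ f ((cmAdelicFrameTransport L N H dV g hg) y)) + toQuotFun (adelicGroupData (↥(maximalRealSubfield L)) L (IsCMField.complexConj L) N H) fun y => (lineThetaKernelDatum L N e₁ dV hdV hdV0 μ hμ a hρ).thetaLiftFun μW Φ₂ f ((cmAdelicFrameTransport L N H dV g hg) y) := by
  haveI := compactSpace_quotient_range_toAdelic_JW L a
  have key : (lineThetaKernelDatum L N e₁ dV hdV hdV0 μ hμ a hρ).thetaLift μW (Φ₁ + Φ₂) f =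
      (lineThetaKernelDatum L N e₁ dV hdV hdV0 μ hμ a hρ).thetaLift μW Φ₁ f + (lineThetaKernelDatum L N e₁ dV hdV hdV0 μ hμ a hρ).thetaLift μW Φ₂ f :=
    @ThetaKernelDatum.thetaLift_add_left _ (↥(piSchwartzBruhat (↥(maximalRealSubfield L)) (Fin n'))) _ _
      (WeilThetaDatum.instTopologicalSpaceThetaTop _) _ _ _ _ _ _ _ _ _ _ (lineThetaKernelDatum L N e₁ dV hdV hdV0 μ hμ a hρ) _ _ _ _ μW
      _ _ _ (lineThetaKernelDatum_thetaLinear L N e₁ dV hdV hdV0 μ hμ a hρ) Φ₁ Φ₂ f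
  funext q
  obtain ⟨x, rfl⟩ := QuotientGroup.mk_surjective q
  simp only [Pi.add_apply]
  rw [show (QuotientGroup.mk x : (adelicGroupData (↥(maximalRealSubfield L)) L (IsCMField.complexConj L) N H).automorphicQuotient) = (adelicGroupData (↥(maximalRealSubfield L)) L (IsCMField.complexConj L) N H).toAutomorphicQuotient x from rfl,
    toQuotFun_lineThetaLift_mk L N H e₁ dV hdV hdV0 g hg μ hμ a hρ μW (Φ₁ + Φ₂) f x, toQuotFun_lineThetaLift_mk L N H e₁ dV hdV hdV0 g hg μ hμ a hρ μW Φ₁ f x, toQuotFun_lineThetaLift_mk L N H e₁ dV hdV hdV0 g hg μ hμ a hρ μW Φ₂ f x,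
    key, ContinuousMap.add_apply]

variable [CompactSpace (adelicGroupData (↥(maximalRealSubfield L)) L (IsCMField.complexConj L) N H).automorphicQuotient]
  (ν : Measure (adelicGroupData (↥(maximalRealSubfield L)) L (IsCMField.complexConj L) N H).automorphicQuotient) [IsFiniteMeasure ν]

omit [BorelSpace (↥(UnitaryGroup.adelic (↥(maximalRealSubfield L)) L (IsCMField.complexConj L) 1 (JW (↥(maximalRealSubfield L)) L a)) ⧸ (UnitaryGroup.toAdelic (↥(maximalRealSubfield L)) L (IsCMField.complexConj L) 1 (JW (↥(maximalRealSubfield L)) L a)).range)] [IsFiniteMeasure μW] in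
/-- **The `L²`-class is homogeneous in `Φ`**: `[Θ̃_{c•Φ}(f) ∘ ιA] = c • [Θ̃_Φ(f) ∘ ιA]` in `L²([U(H)], ν)`.
[cite: Weil1964, Chap. III n° 41 Thm 6 p. 193] -/
theorem toLp_lineThetaLift_smul_left (c : ℂ) (Φ : piSchwartzBruhat (↥(maximalRealSubfield L)) (Fin n')) :
    MemLp.toLp _ (memLp_toQuotFun_lineThetaLift L N H e₁ dV hdV hdV0 g hg μ hμ a hρ μW (c • Φ) f ν 2) =
      c • MemLp.toLp _ (memLp_toQuotFun_lineThetaLift L N H e₁ dV hdV hdV0 g hg μ hμ a hρ μW Φ f ν 2) := by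
  rw [← MemLp.toLp_const_smul]
  exact MemLp.toLp_congr _ _ (Filter.EventuallyEq.of_eq (toQuotFun_lineThetaLift_smul_left L N H e₁ dV hdV hdV0 g hg μ hμ a hρ μW f c Φ))

/-- **The `L²`-class is additive in `Φ`**: `[Θ̃_{Φ₁+Φ₂}(f) ∘ ιA] = [Θ̃_{Φ₁}(f) ∘ ιA] + [Θ̃_{Φ₂}(f) ∘ ιA]` in `L²([U(H)], ν)`.
[cite: Weil1964, Chap. III n° 41 Thm 6 p. 193] -/
theorem toLp_lineThetaLift_add_left (Φ₁ Φ₂ : piSchwartzBruhat (↥(maximalRealSubfield L)) (Fin n')) :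
    MemLp.toLp _ (memLp_toQuotFun_lineThetaLift L N H e₁ dV hdV hdV0 g hg μ hμ a hρ μW (Φ₁ + Φ₂) f ν 2) =
      MemLp.toLp _ (memLp_toQuotFun_lineThetaLift L N H e₁ dV hdV hdV0 g hg μ hμ a hρ μW Φ₁ f ν 2) +
        MemLp.toLp _ (memLp_toQuotFun_lineThetaLift L N H e₁ dV hdV hdV0 g hg μ hμ a hρ μW Φ₂ f ν 2) := by
  rw [← MemLp.toLp_add]
  exact MemLp.toLp_congr _ _ (Filter.EventuallyEq.of_eq (toQuotFun_lineThetaLift_add_left L N H e₁ dV hdV hdV0 g hg μ hμ a hρ μW f Φ₁ Φ₂))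

/-- **PURE-TENSOR REDUCTION.**  If a `ℂ`-linear map `T` out of `L²([U(H)], ν)` does not kill the class `[Θ̃_Φ(f) ∘ ιA]` of SOME
Schwartz–Bruhat `Φ`, then it does not kill the class of some FACTORIZABLE `Φ_∞ ⊗ Φ_f` (`Φ_∞` a Schwartz function on `(L⁺ ⊗ ℝ)^{n′}`, `Φ_f`
Schwartz–Bruhat on `(𝔸_{L⁺}^∞)^{n′}`): the Schwartz–Bruhat space IS the span of the pure tensors (★ `piSchwartzBruhat`) and
`Φ ↦ T [Θ̃_Φ(f) ∘ ιA]` is linear (`toLp_lineThetaLift_add_left ∕ _smul_left`), so its zero set is a submodule — `Submodule.span_induction`.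
No continuity of `T` is needed (exact span). [cite: TateThesis1967, §3.2, §4.2] [cite: Weil1964, Chap. III n° 41 Thm 6 p. 193] -/
theorem exists_tensor_of_apply_toLp_lineThetaLift_ne_zero {X : Type*} [AddCommGroup X] [Module ℂ X] (T : Lp ℂ 2 ν →ₗ[ℂ] X)
    (Φ : piSchwartzBruhat (↥(maximalRealSubfield L)) (Fin n'))
    (hT : T (MemLp.toLp _ (memLp_toQuotFun_lineThetaLift L N H e₁ dV hdV hdV0 g hg μ hμ a hρ μW Φ f ν 2)) ≠ 0) :
    ∃ (Φinf : 𝓢((Fin n' → NumberField.mixedEmbedding.mixedSpace ↥(maximalRealSubfield L)), ℂ))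
      (Φfin : (Fin n' → FiniteAdeleRing (𝓞 ↥(maximalRealSubfield L)) ↥(maximalRealSubfield L)) → ℂ)
      (hfin : Φfin ∈ SchwartzBruhat (Fin n' → FiniteAdeleRing (𝓞 ↥(maximalRealSubfield L)) ↥(maximalRealSubfield L))),
      T (MemLp.toLp _ (memLp_toQuotFun_lineThetaLift L N H e₁ dV hdV hdV0 g hg μ hμ a hρ μW
        ⟨fun v => Φinf (piArch (↥(maximalRealSubfield L)) (Fin n') v) * Φfin (piFinite (↥(maximalRealSubfield L)) (Fin n') v),
          tensor_mem_piSchwartzBruhat Φinf hfin⟩ f ν 2)) ≠ 0 := by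
  by_contra hcon
  push Not at hcon
  -- the functional `Ψ ↦ T [Θ̃_Ψ(f) ∘ ιA]` on the Schwartz–Bruhat space
  let F : piSchwartzBruhat (↥(maximalRealSubfield L)) (Fin n') → X := fun Ψ =>
    T (MemLp.toLp _ (memLp_toQuotFun_lineThetaLift L N H e₁ dV hdV hdV0 g hg μ hμ a hρ μW Ψ f ν 2))
  have hadd : ∀ Ψ₁ Ψ₂, F (Ψ₁ + Ψ₂) = F Ψ₁ + F Ψ₂ := fun Ψ₁ Ψ₂ => by
    simp only [F]
    rw [toLp_lineThetaLift_add_left L N H e₁ dV hdV hdV0 g hg μ hμ a hρ μW f ν Ψ₁ Ψ₂, map_add]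
  have hsmul : ∀ (c : ℂ) Ψ, F (c • Ψ) = c • F Ψ := fun c Ψ => by
    simp only [F]
    rw [toLp_lineThetaLift_smul_left L N H e₁ dV hdV hdV0 g hg μ hμ a hρ μW f ν c Ψ, map_smul]
  have key : ∀ (x : (Fin n' → AdeleRing (𝓞 ↥(maximalRealSubfield L)) ↥(maximalRealSubfield L)) → ℂ)
      (hx : x ∈ piSchwartzBruhat (↥(maximalRealSubfield L)) (Fin n')), F ⟨x, hx⟩ = 0 := by
    intro x hx
    induction hx using Submodule.span_induction with
    | mem x hx =>
        obtain ⟨Φinf, Φfin, hfin, rfl⟩ := hx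
        exact hcon Φinf Φfin hfin
    | zero =>
        have h0 : F 0 = 0 := by
          have h := hsmul 0 0
          rwa [zero_smul, zero_smul] at h
        exact h0
    | add x y hx hy ihx ihy =>
        change F (⟨x, hx⟩ + ⟨y, hy⟩) = 0
        rw [hadd, ihx, ihy, add_zero]
    | smul c x hx ih =>
        change F (c • ⟨x, hx⟩) = 0
        rw [hsmul, ih, smul_zero]
  exact hT (key Φ Φ.2)

end Lift

/-! ## §2 The (C♯)hol frame (`N = 3`): `P` meets the theta lift from `⟨a⟩` at a genuine `χ ∈ Chi` AND a pure tensor `Φ_∞ ⊗ Φ_f` -/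

section HolSeam

variable (L : Type) [Field L] [NumberField L] [IsCMField L] (ι : L →+* ℂ) (H : Matrix (Fin 3) (Fin 3) L) (T : GL (Fin 3) ℂ)
  (hT : (T : Matrix (Fin 3) (Fin 3) ℂ)ᴴ * H.map ι * (T : Matrix (Fin 3) (Fin 3) ℂ) = Literature.Geometry.ComplexHyperbolic.BallModel.J)
  {n' : ℕ} (e₁ : Fin 3 × Fin 1 ≃ Fin n') (dV : Fin 3 → L) (hdV : ∀ i, IsCMField.complexConj L (dV i) = dV i)
  (hdV0 : ∀ i, dV i ≠ 0) (g : GL (Fin 3) L)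
  (hg : ((g : Matrix (Fin 3) (Fin 3) L).map (cmConjRingHom L))ᵀ * H * (g : Matrix (Fin 3) (Fin 3) L) = Matrix.diagonal dV)
  (μ : Literature.NumberTheory.Automorphic.IdeleClassGroup L →ₜ* Circle) (hμ : IsConjugateSymplectic L μ) (a : (↥(maximalRealSubfield L))ˣ)

variable
  [CompactSpace (↥(UnitaryGroup.adelic (↥(maximalRealSubfield L)) L (IsCMField.complexConj L) 3 (Matrix.diagonal dV)) ⧸ (UnitaryGroup.toAdelic (↥(maximalRealSubfield L)) L (IsCMField.complexConj L) 3 (Matrix.diagonal dV)).range)]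

set_option maxHeartbeats 1600000 in
/-- **NODE B through steps (5) + (1b): a holomorphic-cotangent `P` meeting the theta lift from the line `⟨a⟩` meets it at a genuine
`χ ∈ Chi` AND AT A PURE TENSOR `Φ = Φ_∞ ⊗ Φ_f`** — for some majorant witness, measure, Schwartz `Φ_∞` on `(L⁺ ⊗ ℝ)^{n′}`, Schwartz–Bruhat
`Φ_f` on `(𝔸_{L⁺}^∞)^{n′}` and `χ ∈ Chi L⁺ L c̄`, the projection to `P` of the class `[Θ̃_{Φ_∞ ⊗ Φ_f}(charCM (chiQuot a χ)) ∘ ιA]` is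
non-zero (★ `MeetsThetaLiftFromLine.exists_chi_starProjection_ne_zero_of_holCotForm` + `exists_tensor_of_apply_toLp_lineThetaLift_ne_zero`
applied to the linear map `pr_P`).  Same binders and existential order as the ★ source, `Φ` replaced by `(Φinf, Φfin, hfin)`; the input of
node B step (3b) (fix `Φ_∞`, vary `Φ_f`). [cite: Liu2021, proof of Prop. 4.13 Case 1 (l. 2131–2137, p. 48); Def. 4.11 (l. 2090)]
[cite: TateThesis1967, §3.2, §4.2] -/
theorem MeetsThetaLiftFromLine.exists_chi_starProjection_ne_zero_of_holCotForm_tensor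
    {μA : Measure (adelicGroupData (↥(maximalRealSubfield L)) L (IsCMField.complexConj L) 3 H).automorphicQuotient}
    [(adelicGroupData (↥(maximalRealSubfield L)) L (IsCMField.complexConj L) 3 H).IsAutomorphicMeasure μA]
    [CompactSpace (adelicGroupData (↥(maximalRealSubfield L)) L (IsCMField.complexConj L) 3 H).automorphicQuotient]
    (P : DiscreteAutomorphicRep (adelicGroupData (↥(maximalRealSubfield L)) L (IsCMField.complexConj L) 3 H) μA)
    {Φh : (adelicGroupData (↥(maximalRealSubfield L)) L (IsCMField.complexConj L) 3 H).Adelic → (Fin 2 → ℂ)}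
    (hΦh : Φh ∈ holCotForms (↥(maximalRealSubfield L)) L (IsCMField.complexConj L) 3 H (cmArchSection L ι H T hT)
      (cmCompactFactor L ι H T hT))
    {j : Fin 2} (hj : MemLp (toQuotFun (adelicGroupData (↥(maximalRealSubfield L)) L (IsCMField.complexConj L) 3 H) fun x => Φh x j) 2 μA)
    (hjmem : hj.toLp _ ∈ P.space.toSubmodule) (hjne : hj.toLp _ ≠ 0)
    (h : MeetsThetaLiftFromLine L 3 H e₁ dV hdV hdV0 P μ hμ a (cmAdelicFrameTransport L 3 H dV g hg)) :
    letI : MeasurableSpace (↥(UnitaryGroup.adelic (↥(maximalRealSubfield L)) L (IsCMField.complexConj L) 1 (JW (↥(maximalRealSubfield L)) L a)) ⧸ (UnitaryGroup.toAdelic (↥(maximalRealSubfield L)) L (IsCMField.complexConj L) 1 (JW (↥(maximalRealSubfield L)) L a)).range) := borel _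
    haveI := normal_range_toAdelic_JW L a
    ∃ (hρ : HasThetaMajorants fun
      (p : ↥(UnitaryGroup.adelic (↥(maximalRealSubfield L)) L (IsCMField.complexConj L) 3 (Matrix.diagonal dV)) × ↥(UnitaryGroup.adelic (↥(maximalRealSubfield L)) L (IsCMField.complexConj L) 1 (JW (↥(maximalRealSubfield L)) L a))) (Φ : piSchwartzBruhat (↥(maximalRealSubfield L)) (Fin n')) =>
        pairRep (↥(maximalRealSubfield L)) L (IsCMField.complexConj L) 3 1 e₁ (Matrix.diagonal dV) (JW (↥(maximalRealSubfield L)) L a)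
          (chiSplittingLine L e₁ dV hdV hdV0 (toHeckeCharacter L μ) (isUnitary_toHeckeCharacter L μ)
            ((isOscillatorChar_toHeckeCharacter_iff μ).mpr hμ) (TW (↥(maximalRealSubfield L)) a)
            (isUnit_det_TW (↥(maximalRealSubfield L)) a) (JW (↥(maximalRealSubfield L)) L a) (JW_eq (↥(maximalRealSubfield L)) L a))
          p Φ) (μW : Measure (↥(UnitaryGroup.adelic (↥(maximalRealSubfield L)) L (IsCMField.complexConj L) 1 (JW (↥(maximalRealSubfield L)) L a)) ⧸ (UnitaryGroup.toAdelic (↥(maximalRealSubfield L)) L (IsCMField.complexConj L) 1 (JW (↥(maximalRealSubfield L)) L a)).range)) (_ : IsFiniteMeasure μW) (_ : SMulInvariantMeasure ↥(UnitaryGroup.adelic (↥(maximalRealSubfield L)) L (IsCMField.complexConj L) 1 (JW (↥(maximalRealSubfield L)) L a)) (↥(UnitaryGroup.adelic (↥(maximalRealSubfield L)) L (IsCMField.complexConj L) 1 (JW (↥(maximalRealSubfield L)) L a)) ⧸ (UnitaryGroup.toAdelic (↥(maximalRealSubfield L)) L (IsCMField.complexConj L) 1 (JW (↥(maximalRealSubfield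 L)) L a)).range) μW)
      (Φinf : 𝓢((Fin n' → NumberField.mixedEmbedding.mixedSpace ↥(maximalRealSubfield L)), ℂ))
      (Φfin : (Fin n' → FiniteAdeleRing (𝓞 ↥(maximalRealSubfield L)) ↥(maximalRealSubfield L)) → ℂ)
      (hfin : Φfin ∈ SchwartzBruhat (Fin n' → FiniteAdeleRing (𝓞 ↥(maximalRealSubfield L)) ↥(maximalRealSubfield L)))
      (χ : Chi (↥(maximalRealSubfield L)) L (IsCMField.complexConj L))
      (hθ : MemLp (toQuotFun (adelicGroupData (↥(maximalRealSubfield L)) L (IsCMField.complexConj L) 3 H) fun x =>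
        (lineThetaKernelDatum L 3 e₁ dV hdV hdV0 μ hμ a hρ).thetaLiftFun μW
          ⟨fun v => Φinf (piArch (↥(maximalRealSubfield L)) (Fin n') v) * Φfin (piFinite (↥(maximalRealSubfield L)) (Fin n') v),
            tensor_mem_piSchwartzBruhat Φinf hfin⟩
          (charCM (chiQuot (↥(maximalRealSubfield L)) L (IsCMField.complexConj L) (Algebra.IsQuadraticExtension.finrank_eq_two _ L)
            (IsCMField.complexConj_ne_one (K := L)) a χ)) ((cmAdelicFrameTransport L 3 H dV g hg) x)) 2 μA),
      P.space.toSubmodule.starProjection (MemLp.toLp _ hθ) ≠ 0 := by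
  letI : MeasurableSpace (↥(UnitaryGroup.adelic (↥(maximalRealSubfield L)) L (IsCMField.complexConj L) 1 (JW (↥(maximalRealSubfield L)) L a)) ⧸ (UnitaryGroup.toAdelic (↥(maximalRealSubfield L)) L (IsCMField.complexConj L) 1 (JW (↥(maximalRealSubfield L)) L a)).range) := borel _
  haveI : BorelSpace (↥(UnitaryGroup.adelic (↥(maximalRealSubfield L)) L (IsCMField.complexConj L) 1 (JW (↥(maximalRealSubfield L)) L a)) ⧸ (UnitaryGroup.toAdelic (↥(maximalRealSubfield L)) L (IsCMField.complexConj L) 1 (JW (↥(maximalRealSubfield L)) L a)).range) := ⟨rfl⟩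
  haveI := normal_range_toAdelic_JW L a
  obtain ⟨hρ, μW, hfinm, hinv, Φ, χ, hθ, hχ⟩ :=
    h.exists_chi_starProjection_ne_zero_of_holCotForm L ι H T hT e₁ dV hdV hdV0 g hg μ hμ a P hΦh hj hjmem hjne
  haveI : IsFiniteMeasure μW := hfinm
  -- the source's `MemLp` witness is proof-irrelevant: rewrite it as the uniform one, then reduce to a pure tensor
  have hχ' : (P.space.toSubmodule.starProjection : Lp ℂ 2 μA →ₗ[ℂ] Lp ℂ 2 μA)
      (MemLp.toLp _ (memLp_toQuotFun_lineThetaLift L 3 H e₁ dV hdV hdV0 g hg μ hμ a hρ μW Φ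
        (charCM (chiQuot (↥(maximalRealSubfield L)) L (IsCMField.complexConj L) (Algebra.IsQuadraticExtension.finrank_eq_two _ L)
          (IsCMField.complexConj_ne_one (K := L)) a χ)) μA 2)) ≠ 0 := hχ
  obtain ⟨Φinf, Φfin, hfin, hne⟩ := exists_tensor_of_apply_toLp_lineThetaLift_ne_zero L 3 H e₁ dV hdV hdV0 g hg μ hμ a hρ μW
    (charCM (chiQuot (↥(maximalRealSubfield L)) L (IsCMField.complexConj L) (Algebra.IsQuadraticExtension.finrank_eq_two _ L)
      (IsCMField.complexConj_ne_one (K := L)) a χ)) μA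
    (P.space.toSubmodule.starProjection : Lp ℂ 2 μA →ₗ[ℂ] Lp ℂ 2 μA) Φ hχ'
  exact ⟨hρ, μW, hfinm, hinv, Φinf, Φfin, hfin, χ, memLp_toQuotFun_lineThetaLift L 3 H e₁ dV hdV hdV0 g hg μ hμ a hρ μW _ _ μA 2, hne⟩

end HolSeam

end Literature.NumberTheory.Automorphic.Liu2021

end
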